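import Summits.HodgeConjecture.HodgeConjecture.Theorems.RigidRelativesJacobianTorelliRelativesTateAlgebraicLeftInverse
import Summits.HodgeConjecture.HodgeConjecture.Theorems.RigidRelativesJacobianTorelliRelativesTateAlgebraicComp
import Literature.NumberTheory.EllipticCurves.KugaSatoVariety
import Literature.AlgebraicGeometry.Motives.CurveNet
import HarnessLib

/-!
# Crux `RelativesTate` (stmt-HodgeConjecture-18578), line `birth` — the skeleton's composition RUN WITH STUBS 2 AND 4
# DISCHARGED: the crux from the anchor (stub 1) and the transit (stub 3) alone

Route `HodgeConjecture/RigidRelativesJacobianTorelli`, crux `RelativesTate` (rank 2). Registered skeleton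
`Cruxes/RelativesTate/Lines/birth.lean`: `RelativesTate_of : Sig.stub_kugaSatoAnchor → Sig.stub_algebraicLeftInverse →
Sig.stub_kugaSatoTransit → Sig.stub_algebraicComp → RelativesTate`. Stub 4 is landed verbatim
(`Theorems.RelativesTate.stub_algebraicComp`, file `…RelativesTateAlgebraicComp`) and stub 2 in the skeleton's spelling with
its carriers unfolded (`Theorems.RelativesTate.algebraicLeftInverse`, file `…RelativesTateAlgebraicLeftInverse`). This file
re-runs the skeleton's ten-line composition with those two theorems plugged in:

* `relativesTate_of_kugaSatoAnchor_of_kugaSatoTransit : Sig₁ → Sig₃ → Theses.RigidRelativesJacobianTorelli.RelativesTate`,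
  hypotheses = the statements of the two OPEN stubs (`stub_kugaSatoAnchor`: every rigid-type threefold over `ℚ` is anchored
  by an injective algebraic correspondence on `H³` in a weight-4 Kuga–Sato hub — the geometric realisation of modularity;
  `stub_kugaSatoTransit`: inside the hubs, relatives' anchored planes are joined by an algebraic correspondence — Tate inside
  the hub), written VERBATIM in the skeleton's spelling through file-local notations for its carriers `cx`, `Rigid`,
  `GalIso`, `IsKugaSatoHub` (display only; nothing is defined); conclusion = the route's crux decl BY NAME.

So the crux `RelativesTate` IS, in the kernel, "anchor + transit": the two statements about Kuga–Sato threefolds that the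
line isolates as its research content (sizes XL; Gouvêa–Yui modularity + Scholl's motives + Tate for `W × X`, resp. for
`End` of the `[f]`-part of `H³(W)`). Also recorded: `stub_algebraicLeftInverse` in the skeleton's VERBATIM spelling
(the notations make the statement literally the registered one; it is `algebraicLeftInverse`).

HONEST STATUS. Nothing here is a case of the Hodge or Tate conjectures: the theorem is an implication whose hypotheses are
the crux's two open stubs. No definition (the carriers are file-local notations), no named fact, no sorry.
References: [Scholl1990] §1 (1.2.0–1.2.4), §4; [GouveaYui2011] Thm. 1; [Kleiman1968AlgebraicCycles] §1.3, §3;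
[Fulton1998] §16.1; [VoisinHodgeI2002] §6.3.2 Thm. 6.32; [Ramakrishnan2000] §4.1.
-/

noncomputable section

-- every declaration of this problem lives in `Summit.HodgeConjecture.HodgeConjecture.…` (summit = sub-problem)
set_option linter.dupNamespace false

open CategoryTheory AlgebraicGeometry
open Literature.AlgebraicGeometry.Motives Literature.AlgebraicGeometry.HodgeTheory
open Literature.NumberTheory.EllipticCurves (KugaSatoVariety)

namespace Summit.HodgeConjecture.HodgeConjecture.Theorems.RelativesTate

/-! ## The skeleton's carriers, as file-local notations (display only) -/

/-- `cx Y₀ = Y₀ ⊗_ℚ ℂ` — the crux's `let cx`. -/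
local notation3 "cx " Y₀:max => (baseChange ℚ ℂ).obj Y₀

/-- `Rigid Y₀` — the crux's `let Rigid`: smooth projective threefold over `ℚ`, `dim H³((Y₀)_ℂ; ℂ) = 2`, a non-zero
`(3,0)`-class. -/
local notation3 "Rigid " Y₀:max => (IsSmoothProjective 3 Y₀ ∧ Module.finrank ℂ (complexBetti (cx Y₀) 3) = 2 ∧
    ∃ x : complexBetti (cx Y₀) 3, x ≠ 0 ∧ IsOfHodgeType 3 (cx Y₀) 3 3 0 x)

/-- `GalIso Y₀ Y₀'` — the crux's `let GalIso`: the rational `ℓ`-adic `H³` are isomorphic on an open subgroup of `Gal(ℚ̄/ℚ)`. -/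
local notation3 "GalIso " Y₀:max Y₀':max => (∃ (ℓ : ℕ) (_ : Fact ℓ.Prime) (U : OpenSubgroup (Field.absoluteGaloisGroup ℚ))
    (e : ellAdicEtaleCohomologyRat ℓ 3 (geometricFibre ℚ Y₀) ≃ₗ[ℚ_[ℓ]] ellAdicEtaleCohomologyRat ℓ 3 (geometricFibre ℚ Y₀')),
    ∀ g ∈ U, e.toLinearMap ∘ₗ geometricEllAdicEtaleCohomologyRepRat ℓ Y₀ 3 g =
      geometricEllAdicEtaleCohomologyRepRat ℓ Y₀' 3 g ∘ₗ e.toLinearMap)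

/-- `IsKugaSatoHub Y` — the skeleton's hub predicate: `Y ≅ (V.W)_σ` for a weight-4 Kuga–Sato threefold `V` over a number field. -/
local notation3 "IsKugaSatoHub " Y:max => (∃ (N : ℕ) (K : Type) (_ : Field K) (_ : NumberField K) (σ : K →+* ℂ)
    (V : KugaSatoVariety K 2 N), Nonempty (Y ≅ (baseChangeHom σ).obj V.W))

/-! ## The carriers are the crux's (`Iff.rfl`), and the hub is a smooth projective threefold -/

/-- **The crux is literally the statement over these carriers** (`Iff.rfl`). [folklore] -/
theorem relativesTate_iff :
    Summit.HodgeConjecture.HodgeConjecture.Theses.RigidRelativesJacobianTorelli.RelativesTate ↔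
      ∀ ⦃X₀ X₀' : SchemeOver.{0} ℚ⦄, Rigid X₀ → Rigid X₀' → GalIso X₀ X₀' →
        ∃ Ψ : complexBetti (cx X₀) 3 →ₗ[ℂ] complexBetti (cx X₀') 3,
          IsAlgebraicCorrespondence 3 3 (cx X₀') (cx X₀) Ψ ∧ Function.Bijective Ψ :=
  Iff.rfl

/-- A Kuga–Sato hub is a smooth projective complex threefold (`KugaSatoVariety.smoothProjective`, base change along `σ`,
invariance under isomorphism). [cite: Scholl1990, §1 and §3] -/
theorem isSmoothProjective_of_isKugaSatoHub {Y : SchemeOver.{0} ℂ} (h : IsKugaSatoHub Y) : IsSmoothProjective 3 Y := by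
  obtain ⟨N, K, _, _, σ, V, ⟨e⟩⟩ := h
  exact IsSmoothProjective.of_iso e.symm (IsSmoothProjective.baseChangeHom_holds σ V.smoothProjective)

/-! ## Stub 2 in the registered spelling -/

/-- **Stub `stub_algebraicLeftInverse` of crux `RelativesTate` (registered signature, verbatim in the skeleton's spelling):**
an injective algebraic correspondence out of `H³` of a rigid-type threefold into `H³` of a smooth projective complex threefold
has an algebraic left inverse (`algebraicLeftInverse`: conjugate transpose, Hodge–Riemann on `H^{3,0} ⊕ H^{0,3}`,
Cayley–Hamilton). [cite: Kleiman1968AlgebraicCycles, Appendix to §2 (Thm. 2A11) and §3] [cite: VoisinHodgeI2002, §6.3.2 Thm. 6.32] -/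
theorem stub_algebraicLeftInverse :
    ∀ ⦃X₀ : SchemeOver.{0} ℚ⦄, Rigid X₀ → ∀ ⦃Y : SchemeOver.{0} ℂ⦄, IsSmoothProjective 3 Y →
      ∀ (A : complexBetti (cx X₀) 3 →ₗ[ℂ] complexBetti Y 3),
        IsAlgebraicCorrespondence 3 3 Y (cx X₀) A → Function.Injective A →
          ∃ B : complexBetti Y 3 →ₗ[ℂ] complexBetti (cx X₀) 3,
            IsAlgebraicCorrespondence 3 3 (cx X₀) Y B ∧ B ∘ₗ A = LinearMap.id :=
  algebraicLeftInverse

/-! ## The composition, with stubs 2 and 4 discharged -/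

/-- **`RelativesTate` from the anchor and the transit alone** (the skeleton's `RelativesTate_of` with
`stub_algebraicLeftInverse := algebraicLeftInverse` and `stub_algebraicComp := stub_algebraicComp` plugged in). Given
rigid-type relatives `X₀, X₀'`: anchor both (hypothesis 1) in Kuga–Sato hubs `Y, Y'`; left-invert the second anchor,
`B' ∘ A' = id` (THEOREM); transit `T` with `T ∘ A` injective and `range (T ∘ A) ≤ range A'` (hypothesis 2); then
`Ψ := B' ∘ (T ∘ A)` is algebraic (composition, THEOREM), injective, and bijective by `finrank = 2` on both sides.
[cite: Scholl1990, §1 (1.2.0–1.2.4) and §4] [cite: Kleiman1968AlgebraicCycles, §3] [cite: Fulton1998, §16.1 Prop. 16.1.1] -/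
theorem relativesTate_of_kugaSatoAnchor_of_kugaSatoTransit
    (hAnchor : ∀ ⦃X₀ : SchemeOver.{0} ℚ⦄, Rigid X₀ →
      ∃ Y : SchemeOver.{0} ℂ, IsKugaSatoHub Y ∧
        ∃ A : complexBetti (cx X₀) 3 →ₗ[ℂ] complexBetti Y 3,
          IsAlgebraicCorrespondence 3 3 Y (cx X₀) A ∧ Function.Injective A)
    (hTransit : ∀ ⦃X₀ X₀' : SchemeOver.{0} ℚ⦄, Rigid X₀ → Rigid X₀' → GalIso X₀ X₀' →
      ∀ ⦃Y Y' : SchemeOver.{0} ℂ⦄, IsKugaSatoHub Y → IsKugaSatoHub Y' →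
        ∀ (A : complexBetti (cx X₀) 3 →ₗ[ℂ] complexBetti Y 3)
          (A' : complexBetti (cx X₀') 3 →ₗ[ℂ] complexBetti Y' 3),
          IsAlgebraicCorrespondence 3 3 Y (cx X₀) A → Function.Injective A →
          IsAlgebraicCorrespondence 3 3 Y' (cx X₀') A' → Function.Injective A' →
            ∃ T : complexBetti Y 3 →ₗ[ℂ] complexBetti Y' 3,
              IsAlgebraicCorrespondence 3 3 Y' Y T ∧ Function.Injective (T ∘ₗ A) ∧
                LinearMap.range (T ∘ₗ A) ≤ LinearMap.range A') :
    Summit.HodgeConjecture.HodgeConjecture.Theses.RigidRelativesJacobianTorelli.RelativesTate := by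
  refine relativesTate_iff.2 fun X₀ X₀' hX hX' hGal ↦ ?_
  -- anchors (hypothesis 1)
  obtain ⟨Y, hY, A, hA, hAinj⟩ := hAnchor hX
  obtain ⟨Y', hY', A', hA', hA'inj⟩ := hAnchor hX'
  have hYsm : IsSmoothProjective 3 Y := isSmoothProjective_of_isKugaSatoHub hY
  have hY'sm : IsSmoothProjective 3 Y' := isSmoothProjective_of_isKugaSatoHub hY'
  have hXc : IsSmoothProjective 3 (cx X₀) := IsSmoothProjective.baseChange_holds (k := ℚ) ℂ hX.1
  have hX'c : IsSmoothProjective 3 (cx X₀') := IsSmoothProjective.baseChange_holds (k := ℚ) ℂ hX'.1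
  -- algebraic left inverse of the second anchor (THEOREM, stub 2)
  obtain ⟨B', hB', hB'A'⟩ := algebraicLeftInverse hX' hY'sm A' hA' hA'inj
  -- transit inside the hub (hypothesis 2)
  obtain ⟨T, hT, hTAinj, hTA⟩ := hTransit hX hX' hGal hY hY' A A' hA hAinj hA' hA'inj
  refine ⟨B' ∘ₗ (T ∘ₗ A), ?_, ?_⟩
  · -- composition (THEOREM, stub 4), twice
    exact isAlgebraicCorrespondence_comp_three hXc hY'sm hX'c (isAlgebraicCorrespondence_comp_three hXc hYsm hY'sm hA hT) hB'
  · -- bijectivity: injective by the left inverse, surjective by `finrank = 2` on both sides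
    have hB'A'_apply : ∀ z, B' (A' z) = z := fun z ↦ by
      simpa using LinearMap.congr_fun hB'A' z
    have hinj : Function.Injective (B' ∘ₗ (T ∘ₗ A)) := by
      intro x y hxy
      apply hTAinj
      obtain ⟨u, hu⟩ := LinearMap.mem_range.1 (hTA (LinearMap.mem_range_self (T ∘ₗ A) x))
      obtain ⟨v, hv⟩ := LinearMap.mem_range.1 (hTA (LinearMap.mem_range_self (T ∘ₗ A) y))
      have hxy' : B' ((T ∘ₗ A) x) = B' ((T ∘ₗ A) y) := by
        simpa [LinearMap.comp_apply] using hxy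
      rw [← hu, ← hv, hB'A'_apply, hB'A'_apply] at hxy'
      rw [← hu, ← hv, hxy']
    haveI : Module.Finite ℂ (complexBetti (cx X₀) 3) :=
      Module.finite_of_finrank_pos (by rw [hX.2.1]; exact Nat.succ_pos 1)
    haveI : Module.Finite ℂ (complexBetti (cx X₀') 3) :=
      Module.finite_of_finrank_pos (by rw [hX'.2.1]; exact Nat.succ_pos 1)
    exact ⟨hinj, (LinearMap.injective_iff_surjective_of_finrank_eq_finrank
      (hX.2.1.trans hX'.2.1.symm)).1 hinj⟩

end Summit.HodgeConjecture.HodgeConjecture.Theorems.RelativesTate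

end
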